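import Summits.KontsevichZagierPeriods.Zeta5Search.SymRayRecurrence
import HarnessLib

/-!
# Zudilin's recursion (8) on the symmetric ray: transfer to `U`, `W`, `V` (cell `pub-zeta5`, P1)

HONEST FRAMING: systematic search; no irrationality claim unless certified.

OUR work (Summit side), P1 seat generation 3. From the rational identity `Σ_i P_i(n) R_{n+i}(t) + G(t) − G(t+1) = 0`
(`SymRayRecurrence.rec_identity_ray`, certificate `G` with lattice poles of order `≤ 7`, `exists_pf_G`) and uniqueness of
partial fractions (`BallRivoal.pf_unique`), the combined data vanish identically (`ray_data_zero`); summing the order-`5`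
(resp. order-`3`) coefficients gives the recursion for `U` (resp. `W`), and pairing with `H_p^{(o+1)}` — using `G(0) = 0`
(`ev2_symG_zero`, `Vfun_shiftUp`) — gives it for the constant term `V`:

  `P₃(n)X(b_{n+3}) + P₂(n)X(b_{n+2}) + P₁(n)X(b_{n+1}) + P₀(n)X(b_n) = 0`,  `X ∈ {U, W, V}`, `b_m = (3m;m⁷)`, all `n`

(`ray_recurrence_U/W/V`): the recursion (8) of Zudilin, Mat. Zametki 72 (2002), in the gauge `X = (2/m!⁴)x` — the first
claim of his Theorem 2, here a theorem for the CANONICAL coefficients of the wedge dictionary (`WedgeDictionary.coeffU/W/V`).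
-/

noncomputable section

open Finset Polynomial

namespace Summit.KontsevichZagierPeriods.Zeta5Search.SymRay

open Summit.KontsevichZagierPeriods.Zeta5Search.DualSeries
open Summit.KontsevichZagierPeriods.Zeta5Search.WedgeDictionary
open Summit.KontsevichZagierPeriods.Zeta5Search.PolyReflect
open Literature.NumberTheory.Transcendental
open Literature.NumberTheory.Transcendental.BallRivoal (pfEval pf_unique poch_pos harm)

/-! ### Linear bookkeeping for six-term combinations of data -/

/-- The six-term combination of data used in the transfer. -/
def comb6 (a0 a1 a2 a3 : ℚ) (c0 c1 c2 c3 d e : ℕ → ℕ → ℚ) : ℕ → ℕ → ℚ := fun o p =>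
  a0 * c0 o p + a1 * c1 o p + a2 * c2 o p + a3 * c3 o p + d o p - e o p

/-- `pfEval` of the combination. -/
theorem pfEval_comb6 (N K : ℕ) (a0 a1 a2 a3 : ℚ) (c0 c1 c2 c3 d e : ℕ → ℕ → ℚ) (t : ℚ) :
    pfEval N K (comb6 a0 a1 a2 a3 c0 c1 c2 c3 d e) t =
      a0 * pfEval N K c0 t + a1 * pfEval N K c1 t + a2 * pfEval N K c2 t + a3 * pfEval N K c3 t +
        pfEval N K d t - pfEval N K e t := by
  unfold pfEval comb6
  simp only [add_div, sub_div, mul_div_assoc, sum_add_distrib, sum_sub_distrib, mul_sum]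

/-- Order sums of the combination. -/
theorem sum_comb6 (N : ℕ) (a0 a1 a2 a3 : ℚ) (c0 c1 c2 c3 d e : ℕ → ℕ → ℚ) (o : ℕ) :
    ∑ p ∈ range (N + 1), comb6 a0 a1 a2 a3 c0 c1 c2 c3 d e o p =
      a0 * ∑ p ∈ range (N + 1), c0 o p + a1 * ∑ p ∈ range (N + 1), c1 o p + a2 * ∑ p ∈ range (N + 1), c2 o p +
        a3 * ∑ p ∈ range (N + 1), c3 o p + ∑ p ∈ range (N + 1), d o p - ∑ p ∈ range (N + 1), e o p := by
  unfold comb6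
  simp only [sum_add_distrib, sum_sub_distrib, mul_sum]

/-- `Vfun` of the combination. -/
theorem Vfun_comb6 (N K : ℕ) (a0 a1 a2 a3 : ℚ) (c0 c1 c2 c3 d e : ℕ → ℕ → ℚ) :
    Vfun N K (comb6 a0 a1 a2 a3 c0 c1 c2 c3 d e) =
      a0 * Vfun N K c0 + a1 * Vfun N K c1 + a2 * Vfun N K c2 + a3 * Vfun N K c3 + Vfun N K d - Vfun N K e := by
  unfold Vfun comb6
  simp only [add_mul, sub_mul, mul_assoc, sum_add_distrib, sum_sub_distrib, mul_sum]

/-- `V(bRay m)` is `Vfun` of the canonical data. -/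
theorem Vfun_ray (m : ℕ) : Vfun (3 * m) 6 (pfData (bRay m)) = coeffV (bRay m) := by
  rw [coeffV_ray]; rfl

/-! ### The combined data vanish -/

/-- **The combined data of the telescoping identity vanish identically** (uniqueness of partial fractions). -/
theorem ray_data_zero (n : ℕ) : ∃ d : ℕ → ℕ → ℚ,
    (∀ s : ℚ, (∀ p, p ≤ 3 * n + 6 → s + p + 1 ≠ 0) →
      pfEval (3 * n + 6) 7 d s = (gPolyT n).eval s / BallRivoal.poch (s + 1) (3 * n + 7) ^ 7) ∧
    ∀ o p, o < 7 → p ≤ 3 * (n + 3) →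
      comb6 (ev1 symP0 n) (ev1 symP1 n) (ev1 symP2 n) (ev1 symP3 n)
        (padData (3 * n) (cut (pfData (bRay n)))) (padData (3 * (n + 1)) (cut (pfData (bRay (n + 1)))))
        (padData (3 * (n + 2)) (cut (pfData (bRay (n + 2))))) (cut (pfData (bRay (n + 3))))
        (padData (3 * n + 6) d) (padData (3 * n + 7) (shiftUp d)) o p = 0 := by
  obtain ⟨d, hd⟩ := exists_pf_G n
  refine ⟨d, hd, fun o p ho hp => data_eq_zero_of_pfEval_zero (3 * (n + 3)) 7 _ (fun t => ?_) ho hp⟩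
  rw [pfEval_comb6, pfEval_padData (by omega), pfEval_padData (by omega), pfEval_padData (by omega),
    pfEval_padData (by omega), pfEval_padData (by omega), pfEval_cut, pfEval_cut, pfEval_cut, pfEval_cut,
    show 3 * n + 7 = (3 * n + 6) + 1 by ring, pfEval_shiftUp]
  exact rec_identity_ray n t d hd

/-! ### The recursion for `U`, `W`, `V` -/

/-- **Zudilin's recursion (8) for `U` on the ray**: `P₃U(b_{n+3}) + P₂U(b_{n+2}) + P₁U(b_{n+1}) + P₀U(b_n) = 0`. -/
theorem ray_recurrence_U (n : ℕ) :
    ev1 symP3 n * coeffU (bRay (n + 3)) + ev1 symP2 n * coeffU (bRay (n + 2)) + ev1 symP1 n * coeffU (bRay (n + 1)) +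
      ev1 symP0 n * coeffU (bRay n) = 0 := by
  obtain ⟨d, _, hz⟩ := ray_data_zero n
  have h : ∑ p ∈ range (3 * (n + 3) + 1), comb6 (ev1 symP0 n) (ev1 symP1 n) (ev1 symP2 n) (ev1 symP3 n)
      (padData (3 * n) (cut (pfData (bRay n)))) (padData (3 * (n + 1)) (cut (pfData (bRay (n + 1)))))
      (padData (3 * (n + 2)) (cut (pfData (bRay (n + 2))))) (cut (pfData (bRay (n + 3))))
      (padData (3 * n + 6) d) (padData (3 * n + 7) (shiftUp d)) 4 p = 0 :=
    sum_eq_zero fun p hp => hz 4 p (by norm_num) (Nat.lt_succ_iff.1 (mem_range.1 hp))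
  rw [sum_comb6, sum_padData (by omega), sum_padData (by omega), sum_padData (by omega), sum_padData (by omega),
    sum_padData (by omega), sum_cut _ _ (by norm_num), sum_cut _ _ (by norm_num), sum_cut _ _ (by norm_num),
    sum_cut _ _ (by norm_num), show 3 * n + 7 + 1 = (3 * n + 6) + 2 by ring, sum_shiftUp] at h
  rw [coeffU_ray, coeffU_ray, coeffU_ray, coeffU_ray]
  linear_combination h

/-- **Zudilin's recursion (8) for `W` on the ray.** -/
theorem ray_recurrence_W (n : ℕ) :
    ev1 symP3 n * coeffW (bRay (n + 3)) + ev1 symP2 n * coeffW (bRay (n + 2)) + ev1 symP1 n * coeffW (bRay (n + 1)) +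
      ev1 symP0 n * coeffW (bRay n) = 0 := by
  obtain ⟨d, _, hz⟩ := ray_data_zero n
  have h : ∑ p ∈ range (3 * (n + 3) + 1), comb6 (ev1 symP0 n) (ev1 symP1 n) (ev1 symP2 n) (ev1 symP3 n)
      (padData (3 * n) (cut (pfData (bRay n)))) (padData (3 * (n + 1)) (cut (pfData (bRay (n + 1)))))
      (padData (3 * (n + 2)) (cut (pfData (bRay (n + 2))))) (cut (pfData (bRay (n + 3))))
      (padData (3 * n + 6) d) (padData (3 * n + 7) (shiftUp d)) 2 p = 0 :=
    sum_eq_zero fun p hp => hz 2 p (by norm_num) (Nat.lt_succ_iff.1 (mem_range.1 hp))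
  rw [sum_comb6, sum_padData (by omega), sum_padData (by omega), sum_padData (by omega), sum_padData (by omega),
    sum_padData (by omega), sum_cut _ _ (by norm_num), sum_cut _ _ (by norm_num), sum_cut _ _ (by norm_num),
    sum_cut _ _ (by norm_num), show 3 * n + 7 + 1 = (3 * n + 6) + 2 by ring, sum_shiftUp] at h
  rw [coeffW_ray, coeffW_ray, coeffW_ray, coeffW_ray]
  linear_combination h

/-- `G(0) = 0`: the certificate vanishes at `t = 0` (its row `t^0` is zero). -/
theorem pfEval_G_zero (n : ℕ) (d : ℕ → ℕ → ℚ)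
    (hd : ∀ s : ℚ, (∀ p, p ≤ 3 * n + 6 → s + p + 1 ≠ 0) →
      pfEval (3 * n + 6) 7 d s = (gPolyT n).eval s / BallRivoal.poch (s + 1) (3 * n + 7) ^ 7) :
    pfEval (3 * n + 6) 7 d 0 = 0 := by
  rw [hd 0 (fun p _ => by positivity), eval_gPolyT, ev2_symG_zero, zero_mul, zero_div]

/-- **Zudilin's recursion (8) for the constant term `V` on the ray.** -/
theorem ray_recurrence_V (n : ℕ) :
    ev1 symP3 n * coeffV (bRay (n + 3)) + ev1 symP2 n * coeffV (bRay (n + 2)) + ev1 symP1 n * coeffV (bRay (n + 1)) +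
      ev1 symP0 n * coeffV (bRay n) = 0 := by
  obtain ⟨d, hd, hz⟩ := ray_data_zero n
  have h := Vfun_eq_zero_of_data (N := 3 * (n + 3)) (K := 7) hz
  rw [Vfun_comb6, Vfun_padData (by omega), Vfun_padData (by omega), Vfun_padData (by omega), Vfun_padData (by omega),
    Vfun_padData (by omega), Vfun_cut, Vfun_cut, Vfun_cut, Vfun_cut, show 3 * n + 7 = (3 * n + 6) + 1 by ring,
    Vfun_shiftUp, pfEval_G_zero n d hd, Vfun_ray, Vfun_ray, Vfun_ray, Vfun_ray] at h
  linear_combination h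

end Summit.KontsevichZagierPeriods.Zeta5Search.SymRay
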